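import Literature.NumberTheory.EllipticCurves.BSDInvariantsProofs
import Literature.NumberTheory.EllipticCurves.QuadraticTwistRank
import Literature.NumberTheory.EllipticCurves.SelmerGaloisAction
import Literature.NumberTheory.EllipticCurves.SelmerPInftyRestriction
import HarnessLib

/-!
# `Sel_{p^∞}` under isomorphisms of curves; the twist `E_d ≅ E` over `ℚ(√d)` on geometric points

Two proved ingredients of the proof of
`Literature.NumberTheory.EllipticCurves.selmerCorank_baseChange_quadratic`
(Dokchitser–Dokchitser 2010, Lemma 4.14 with T. Dokchitser 2013, §4: "`E_α ≅ E` over `K(√α)`"):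

* **Isomorphic curves have corresponding `p^∞`-Selmer local conditions.** For Weierstrass
  curves `W₁, W₂` over a field `K` with `V • W₁ = W₂` (`V` an admissible change of variables over
  `K`), the `Γ_K`-equivariant isomorphism of geometric points `twistPointsIso : E₁(K̄) ≃ E₂(K̄)`
  (the tree's `WeierstrassCurve.geomPointsEquiv` followed by transport along the equality), its
  restriction to `E[p^∞]` (`primaryIso`), the induced `h1PrimaryIso : H¹(K, E₁[p^∞]) ≃ H¹(K, E₂[p^∞])`
  and the correspondence of the Selmer local condition at every `K`-field
  (`mem_selmerLocalKerPrimary_iff_h1PrimaryIso_mem`; Silverman, *AEC*, X.§4: Selmer groups are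
  attached to `E/K`, not to an equation); over a number field, of `Sel_{p^∞}` itself
  (`mem_selmerGroupPInfty_iff_h1PrimaryIso_mem`), whence equal coranks
  (`selmerCorank_eq_of_variableChange`);
* **The twist over the quadratic field.** For `E = W/ℚ`, `K ⊇ ℚ` with `θ ∈ K ∖ ℚ`, `θ² = c`,
  and the completed-square model `W₁ = C • W = W^{(1)}`: the explicit `K`-isomorphisms
  `E^{(c)}_K ≅ W₁_K ≅ E_K` on `K̄`-points (`twistIso = twistIso₂ ∘ twistIso₁`, from the tree's
  `twistUntwist` and `C`), and the sign rule for a lift `τ` of `σ ∈ Aut(K/ℚ)` with `σ θ = -θ`: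
  `twistIso (τ P) = -(τ (twistIso P))` (`twistIso_pointsMap_of_neg`) — the Galois action on
  `E^{(c)}` is that on `E` twisted by the quadratic character (Silverman, *AEC*, X.2 Prop. 2.4 /
  X.5 Cor. 5.4; the tree's `conjMap_twistMap` on rational points).

## References

* J. H. Silverman, *The Arithmetic of Elliptic Curves*, 2nd ed. (2009), X.2 Prop. 2.4, X.§4,
  X.5 Cor. 5.4. [SilvermanAEC2009]
* T. Dokchitser, V. Dokchitser, Ann. of Math. 172 (2010), Lemma 4.14. [DokchitserDokchitserAnnals2010]
-/

noncomputable section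

open scoped Classical

universe u

namespace Literature.NumberTheory.EllipticCurves

open GaloisRepresentations WeierstrassCurve

/-! ## Transport along an equality of Weierstrass equations -/

section Congr

variable {K : Type u} [Field K] {W₁ W₂ : WeierstrassCurve K}

/-- Geometric points along an equality of equations (identity on coordinates). [folklore] -/
def geomPointsCongr (h : W₁ = W₂) : geomPoints W₁ ≃+ geomPoints W₂ := h ▸ AddEquiv.refl _

/-- `geomPointsCongr` on an affine point. [folklore] -/
theorem geomPointsCongr_some (h : W₁ = W₂) {x y : AlgebraicClosure K}
    (hP : (W₁.baseChange (AlgebraicClosure K)).toAffine.Nonsingular x y) :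
    geomPointsCongr h (show geomPoints W₁ from .some x y hP) =
      (show geomPoints W₂ from .some x y (h ▸ hP)) := by
  subst h; rfl

/-- `geomPointsCongr` is `Γ_K`-equivariant. [folklore] -/
theorem geomPointsCongr_smul (h : W₁ = W₂) (g : Field.absoluteGaloisGroup K) (P : geomPoints W₁) :
    geomPointsCongr h (g • P) = g • geomPointsCongr h P := by
  subst h; rfl

variable (E : Type u) [Field E] [Algebra K E]

/-- Local points along an equality of equations. [folklore] -/
def localPointsCongr (h : W₁ = W₂) : localPoints W₁ E ≃+ localPoints W₂ E := h ▸ AddEquiv.refl _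

/-- `localPointsCongr` is `Γ_E`-equivariant. [folklore] -/
theorem localPointsCongr_smul (h : W₁ = W₂) (g : Field.absoluteGaloisGroup E) (P : localPoints W₁ E) :
    localPointsCongr E h (g • P) = g • localPointsCongr E h P := by
  subst h; rfl

/-- The local square for the transport along an equality. [folklore] -/
theorem pointsMap_geomPointsCongr (h : W₁ = W₂) (P : geomPoints W₁) :
    pointsMap W₂ E (geomPointsCongr h P) = localPointsCongr E h (pointsMap W₁ E P) := by
  subst h; rfl

end Congr

/-! ## `Sel_{p^∞}` local conditions under an isomorphism of curves over `K` -/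

section Iso

variable {K : Type u} [Field K] {W₁ W₂ : WeierstrassCurve K} {V : VariableChange K}

/-- An additive isomorphism restricts to the `p`-primary components. [folklore] -/
def primaryComponentCongr {A B : Type*} [AddCommGroup A] [AddCommGroup B] (f : A ≃+ B) (p : ℕ) :
    AddCommGroup.primaryComponent A p ≃+ AddCommGroup.primaryComponent B p where
  toFun a := ⟨f a, map_mem_primaryComponent (f : A →+ B) a.2⟩
  invFun b := ⟨f.symm b, map_mem_primaryComponent (f.symm : B →+ A) b.2⟩
  left_inv _ := Subtype.ext (f.symm_apply_apply _)
  right_inv _ := Subtype.ext (f.apply_symm_apply _)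
  map_add' _ _ := Subtype.ext (map_add f _ _)

/-- Values of `primaryComponentCongr`. [folklore] -/
@[simp]
theorem coe_primaryComponentCongr {A B : Type*} [AddCommGroup A] [AddCommGroup B] (f : A ≃+ B)
    (p : ℕ) (a : AddCommGroup.primaryComponent A p) : (primaryComponentCongr f p a : B) = f a :=
  rfl

/-- **The isomorphism `E₁(K̄) ≃+ E₂(K̄)` of Galois modules induced by `V • W₁ = W₂`** (change of
variables over `K`, the tree's `WeierstrassCurve.geomPointsEquiv`, followed by the transport
along the equality). Silverman, *AEC*, III.3.1(b), X.§4. [folklore] -/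
def twistPointsIso (hV : V • W₁ = W₂) : geomPoints W₁ ≃+ geomPoints W₂ :=
  (geomPointsEquiv W₁ V).trans (geomPointsCongr hV)

/-- `twistPointsIso` on an affine point: the substitution `(x, y) ↦ (u⁻²(x-r), u⁻³(y-s(x-r)-t))`
with the coefficients of `V` viewed in `K̄`. [cite: SilvermanAEC2009, III.1 Table 3.1] -/
theorem twistPointsIso_some (hV : V • W₁ = W₂) {x y : AlgebraicClosure K}
    (hP : (W₁.baseChange (AlgebraicClosure K)).toAffine.Nonsingular x y) :
    ∃ h', twistPointsIso hV (show geomPoints W₁ from .some x y hP) =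
      (show geomPoints W₂ from .some ((V.map (algebraMap K (AlgebraicClosure K))).toX x)
        ((V.map (algebraMap K (AlgebraicClosure K))).toY x y) h') := by
  subst hV
  refine ⟨?_, ?_⟩
  · rw [VariableChange.baseChange_smul_eq, VariableChange.nonsingular_iff]
    exact hP
  · change geomPointsCongr rfl (VariableChange.pointEquivBaseChange W₁ V (AlgebraicClosure K)
      (.some x y hP)) = _
    rw [VariableChange.pointEquivBaseChange_some]
    rfl

/-- `twistPointsIso` is `Γ_K`-equivariant. Silverman, *AEC*, X.§4. [folklore] -/
theorem twistPointsIso_smul (hV : V • W₁ = W₂) (g : Field.absoluteGaloisGroup K) (P : geomPoints W₁) :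
    twistPointsIso hV (g • P) = g • twistPointsIso hV P := by
  change geomPointsCongr hV (geomPointsEquiv W₁ V (g • P)) = g • geomPointsCongr hV (geomPointsEquiv W₁ V P)
  rw [geomPointsEquiv_smul, geomPointsCongr_smul]

variable (E : Type u) [Field E] [Algebra K E]

/-- The companion isomorphism of local points `E₁(K̄_E) ≃+ E₂(K̄_E)`. [folklore] -/
def twistLocalIso (hV : V • W₁ = W₂) : localPoints W₁ E ≃+ localPoints W₂ E :=
  (localPointsEquiv W₁ V E).trans (localPointsCongr E hV)

/-- `twistLocalIso` is `Γ_E`-equivariant. [folklore] -/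
theorem twistLocalIso_smul (hV : V • W₁ = W₂) (g : Field.absoluteGaloisGroup E) (P : localPoints W₁ E) :
    twistLocalIso E hV (g • P) = g • twistLocalIso E hV P := by
  change localPointsCongr E hV (localPointsEquiv W₁ V E (g • P)) =
    g • localPointsCongr E hV (localPointsEquiv W₁ V E P)
  rw [localPointsEquiv_smul, localPointsCongr_smul]

/-- **The local square**: the isomorphisms over `K̄` and `K̄_E` commute with the maps on points
along the chosen embedding `K̄ → K̄_E`. Silverman, *AEC*, X.§4. [folklore] -/
theorem pointsMap_twistPointsIso (hV : V • W₁ = W₂) (P : geomPoints W₁) :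
    pointsMap W₂ E (twistPointsIso hV P) = twistLocalIso E hV (pointsMap W₁ E P) := by
  change pointsMap W₂ E (geomPointsCongr hV (geomPointsEquiv W₁ V P)) =
    localPointsCongr E hV (localPointsEquiv W₁ V E (pointsMap W₁ E P))
  rw [pointsMap_geomPointsCongr, pointsMap_geomPointsEquiv]

variable (p : ℕ)

/-- The isomorphism `E₁[p^∞] ≃+ E₂[p^∞]` induced by `V • W₁ = W₂`. [folklore] -/
def primaryIso (hV : V • W₁ = W₂) : geomPrimaryTorsion W₁ p ≃+ geomPrimaryTorsion W₂ p :=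
  primaryComponentCongr (twistPointsIso hV) p

/-- `primaryIso` is `Γ_K`-equivariant. [folklore] -/
theorem primaryIso_smul (hV : V • W₁ = W₂) (g : Field.absoluteGaloisGroup K)
    (P : geomPrimaryTorsion W₁ p) : primaryIso p hV (g • P) = g • primaryIso p hV P :=
  Subtype.ext (by
    rw [primaryIso, coe_primaryComponentCongr, primaryComponent.coe_smul,
      primaryComponent.coe_smul, coe_primaryComponentCongr, twistPointsIso_smul])

/-- **`H¹(K, E₁[p^∞]) ≃+ H¹(K, E₂[p^∞])`** induced by the `Γ_K`-equivariant `primaryIso`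
(`h1Equiv`). Silverman, *AEC*, X.§4. [folklore] -/
def h1PrimaryIso (hV : V • W₁ = W₂) : galH1Primary W₁ p ≃+ galH1Primary W₂ p :=
  h1Equiv (primaryIso p hV) (primaryIso_smul p hV)

/-- **The `p^∞`-Selmer local conditions of isomorphic curves correspond** at every `K`-field `E`
(`mem_resKer_iff_h1Equiv_mem` applied to the local square `pointsMap_twistPointsIso`).
Silverman, *AEC*, X.§4 (Selmer groups are attached to `E/K`). [cite: SilvermanAEC2009, X.§4] -/
theorem mem_selmerLocalKerPrimary_iff_h1PrimaryIso_mem (hV : V • W₁ = W₂) (s : galH1Primary W₁ p) :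
    s ∈ selmerLocalKerPrimary W₁ E p ↔ h1PrimaryIso p hV s ∈ selmerLocalKerPrimary W₂ E p :=
  mem_resKer_iff_h1Equiv_mem (resGal (K := K) E)
    ((pointsMap W₁ E).comp (geomPrimaryTorsion W₁ p).subtype) _
    ((pointsMap W₂ E).comp (geomPrimaryTorsion W₂ p).subtype) _
    (primaryIso p hV) (primaryIso_smul p hV) (twistLocalIso E hV) (twistLocalIso_smul E hV)
    (fun m ↦ pointsMap_twistPointsIso E hV (m : geomPoints W₁)) s

end Iso

section IsoNumberField

open NumberField IsDedekindDomain

variable {K : Type u} [Field K] [NumberField K] {W₁ W₂ : WeierstrassCurve K} {V : VariableChange K}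
  (p : ℕ)

/-- **Isomorphic curves have corresponding `p^∞`-Selmer groups** (place by place).
[cite: SilvermanAEC2009, X.§4] -/
theorem mem_selmerGroupPInfty_iff_h1PrimaryIso_mem (hV : V • W₁ = W₂) (s : galH1Primary W₁ p) :
    s ∈ selmerGroupPInfty W₁ p ↔ h1PrimaryIso p hV s ∈ selmerGroupPInfty W₂ p := by
  simp only [selmerGroupPInfty, AddSubgroup.mem_inf, AddSubgroup.mem_iInf]
  refine and_congr (forall_congr' fun v ↦ ?_) (forall_congr' fun w ↦ ?_)
  · exact mem_selmerLocalKerPrimary_iff_h1PrimaryIso_mem _ p hV s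
  · exact mem_selmerLocalKerPrimary_iff_h1PrimaryIso_mem _ p hV s

/-- The `p^∞`-Selmer groups of isomorphic curves are isomorphic. [cite: SilvermanAEC2009, X.§4] -/
def selmerGroupPInftyIso (hV : V • W₁ = W₂) : selmerGroupPInfty W₁ p ≃+ selmerGroupPInfty W₂ p :=
  (h1PrimaryIso p hV).addSubgroupMap (selmerGroupPInfty W₁ p) |>.trans
    (AddEquiv.addSubgroupCongr (by
      ext t
      constructor
      · rintro ⟨s, hs, rfl⟩
        exact (mem_selmerGroupPInfty_iff_h1PrimaryIso_mem p hV s).mp hs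
      · intro ht
        refine ⟨(h1PrimaryIso p hV).symm t, ?_, AddEquiv.apply_symm_apply _ _⟩
        have := (mem_selmerGroupPInfty_iff_h1PrimaryIso_mem p hV ((h1PrimaryIso p hV).symm t))
        rw [AddEquiv.apply_symm_apply] at this
        exact this.mpr ht))

/-- **Isomorphic curves have equal `p^∞`-Selmer coranks.** [cite: SilvermanAEC2009, X.§4] -/
theorem selmerCorank_eq_of_variableChange (hV : V • W₁ = W₂) : W₁.selmerCorank p = W₂.selmerCorank p :=
  zpCorank_congr (selmerGroupPInftyIso p hV) p

end IsoNumberField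

/-! ## The twist `E^{(c)} ≅ E` over `K = ℚ(θ)`, `θ² = c`, on `K̄`-points -/

section Twist

variable (W : WeierstrassCurve ℚ) {K : Type u} [Field K] [CharZero K] {θ : K} {c : ℚ}
  (hθ : θ ∉ Set.range (algebraMap ℚ K)) (hc : θ ^ 2 = algebraMap ℚ K c)
  {C : VariableChange ℚ} (hC : C • W = W.quadraticTwist 1)

include hC in
/-- `C_K • E_K = W^{(1)}_K` (base change of `C • W = W^{(1)}`). [folklore] -/
theorem map_smul_baseChange_eq_quadraticTwist_one : C.map (algebraMap ℚ K) • W.baseChange K = (W.quadraticTwist 1).baseChange K := by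
  rw [← VariableChange.baseChange_smul_eq, hC]

/-- The first half `E^{(c)}_K(K̄) ≃+ W^{(1)}_K(K̄)` of the twist isomorphism (`u = θ`).
[cite: SilvermanAEC2009, X.5 Cor. 5.4] -/
def twistIso₁ : geomPoints ((W.quadraticTwist c).baseChange K) ≃+
    geomPoints ((W.quadraticTwist 1).baseChange K) :=
  twistPointsIso (twistUntwist_smul_baseChange W hθ hc)

/-- The second half `W^{(1)}_K(K̄) ≃+ E_K(K̄)` of the twist isomorphism (the completed square
`C`, defined over `ℚ`). [folklore] -/
def twistIso₂ : geomPoints ((W.quadraticTwist 1).baseChange K) ≃+ geomPoints (W.baseChange K) :=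
  (twistPointsIso (map_smul_baseChange_eq_quadraticTwist_one W hC (K := K))).symm

/-- **The twist isomorphism `E^{(c)}_K(K̄) ≃+ E_K(K̄)` over `K = ℚ(θ)`.**
[cite: SilvermanAEC2009, X.5 Cor. 5.4] -/
def twistIso : geomPoints ((W.quadraticTwist c).baseChange K) ≃+ geomPoints (W.baseChange K) :=
  (twistIso₁ W hθ hc).trans (twistIso₂ W hC)

/-- Unfolding `twistIso`. [folklore] -/
theorem twistIso_apply (P : geomPoints ((W.quadraticTwist c).baseChange K)) :
    twistIso W hθ hc hC P = twistIso₂ W hC (twistIso₁ W hθ hc P) :=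
  rfl

/-- `twistIso₁` is `Γ_K`-equivariant. [folklore] -/
theorem twistIso₁_smul (g : Field.absoluteGaloisGroup K)
    (P : geomPoints ((W.quadraticTwist c).baseChange K)) :
    twistIso₁ W hθ hc (g • P) = g • twistIso₁ W hθ hc P :=
  twistPointsIso_smul _ g P

/-- `twistIso₂` is `Γ_K`-equivariant. [folklore] -/
theorem twistIso₂_smul (g : Field.absoluteGaloisGroup K)
    (P : geomPoints ((W.quadraticTwist 1).baseChange K)) :
    twistIso₂ W hC (g • P) = g • twistIso₂ W hC P :=
  symm_equivariant (twistPointsIso (map_smul_baseChange_eq_quadraticTwist_one W hC (K := K)))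
    (twistPointsIso_smul _) g P

/-- `twistIso` is `Γ_K`-equivariant. [folklore] -/
theorem twistIso_smul (g : Field.absoluteGaloisGroup K) (P : geomPoints ((W.quadraticTwist c).baseChange K)) :
    twistIso W hθ hc hC (g • P) = g • twistIso W hθ hc hC P := by
  rw [twistIso_apply, twistIso_apply, twistIso₁_smul, twistIso₂_smul]

variable {σ : K ≃ₐ[ℚ] K} {τ : AlgebraicClosure K ≃+* AlgebraicClosure K}

/-- A lift `τ` of `σ` on an affine point of `X_K(K̄)`, `X/ℚ`: `τ (x, y) = (τ x, τ y)`. [folklore] -/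
theorem IsLiftOfAut.pointsMap_some (hτ : IsLiftOfAut σ τ) (X : WeierstrassCurve ℚ) {x y : AlgebraicClosure K}
    (h : ((X.baseChange K).baseChange (AlgebraicClosure K)).toAffine.Nonsingular x y) :
    ∃ h', hτ.pointsMap X (show geomPoints (X.baseChange K) from .some x y h) =
      (show geomPoints (X.baseChange K) from .some (τ x) (τ y) h') := by
  refine ⟨?_, ?_⟩
  · exact (WeierstrassCurve.Affine.baseChange_nonsingular (W := X.toAffine) (A := AlgebraicClosure K) (B := AlgebraicClosure K)
      (S := ℚ) (f := hτ.algEquiv.toAlgHom) (hτ.algEquiv).injective x y).mpr h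
  · rfl

/-- Negation on the completed-square model over `K̄`: `-(x, y) = (x, -y)` (`a₁ = a₃ = 0`).
[folklore] -/
theorem neg_some_quadraticTwist_one {x y : AlgebraicClosure K}
    (h : (((W.quadraticTwist 1).baseChange K).baseChange (AlgebraicClosure K)).toAffine.Nonsingular x y) :
    ∃ h', -(show geomPoints ((W.quadraticTwist 1).baseChange K) from .some x y h) =
      (show geomPoints ((W.quadraticTwist 1).baseChange K) from .some x (-y) h') := by
  refine ⟨?_, ?_⟩
  · have := (WeierstrassCurve.Affine.nonsingular_neg (W' := (((W.quadraticTwist 1).baseChange K).baseChange (AlgebraicClosure K)).toAffine) x y).mpr h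
    simpa [Affine.negY, baseChange] using this
  · change -(WeierstrassCurve.Affine.Point.some x y h) = _
    rw [WeierstrassCurve.Affine.Point.neg_some]
    exact Affine.Point.some_eq_some_of_eq rfl (by simp [Affine.negY, baseChange])

include hc in
/-- **The sign rule for the first half**: for a lift `τ` of `σ` with `σ θ = -θ`,
`twistIso₁ (τ P) = -(τ (twistIso₁ P))` — the substitution `u = θ` becomes `u = -θ` under `τ`,
and `(x/θ², -y/θ³) = -(x/θ², y/θ³)` on the completed square (Silverman, *AEC*, X.2, proof of
Prop. 2.4; the tree's `conjMap_twistMap`). [cite: SilvermanAEC2009, X.5 Cor. 5.4] -/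
theorem twistIso₁_pointsMap_of_neg (hτ : IsLiftOfAut σ τ) (hσ : σ θ = -θ)
    (P : geomPoints ((W.quadraticTwist c).baseChange K)) :
    twistIso₁ W hθ hc (hτ.pointsMap (W.quadraticTwist c) P) =
      -hτ.pointsMap (W.quadraticTwist 1) (twistIso₁ W hθ hc P) := by
  have hτθ : τ (algebraMap K (AlgebraicClosure K) θ) = -algebraMap K (AlgebraicClosure K) θ := by rw [hτ, hσ, map_neg]
  change (((W.quadraticTwist c).baseChange K).baseChange (AlgebraicClosure K)).toAffine.Point at P
  rcases P with _ | ⟨x, y, h⟩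
  · change twistIso₁ W hθ hc (hτ.pointsMap (W.quadraticTwist c) 0) =
      -hτ.pointsMap (W.quadraticTwist 1) (twistIso₁ W hθ hc 0)
    simp only [map_zero, neg_zero]
  · obtain ⟨h1, e1⟩ := hτ.pointsMap_some (W.quadraticTwist c) h
    obtain ⟨h2, e2⟩ := twistPointsIso_some (twistUntwist_smul_baseChange W hθ hc) h1
    obtain ⟨h3, e3⟩ := twistPointsIso_some (twistUntwist_smul_baseChange W hθ hc) h
    obtain ⟨h4, e4⟩ := hτ.pointsMap_some (W.quadraticTwist 1) h3
    obtain ⟨h5, e5⟩ := neg_some_quadraticTwist_one W (K := K) h4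
    change twistIso₁ W hθ hc (hτ.pointsMap (W.quadraticTwist c) (show geomPoints _ from .some x y h)) = _
    rw [e1, twistIso₁, e2, e3, e4, e5]
    apply Affine.Point.some_eq_some_of_eq
    · simp only [VariableChange.toX_def, VariableChange.map, twistUntwist, Units.coe_map,
        MonoidHom.coe_coe, Units.val_inv_eq_inv_val, Units.val_mk0, map_zero, sub_zero, map_mul,
        map_pow, map_inv₀, hτθ, inv_neg, Even.neg_pow (by decide : Even 2)]
    · simp only [VariableChange.toY_def, VariableChange.map, twistUntwist, Units.coe_map,
        MonoidHom.coe_coe, Units.val_inv_eq_inv_val, Units.val_mk0, map_zero, sub_zero, zero_mul,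
        map_mul, map_pow, map_inv₀, hτθ, inv_neg, Odd.neg_pow (by decide : Odd 3), neg_mul,
        neg_neg]

/-- `C_K` viewed in `K̄` is `C` viewed in `K̄` (the coefficients are rational). [folklore] -/
theorem map_map_algebraMap :
    (C.map (algebraMap ℚ K)).map (algebraMap K (AlgebraicClosure K)) = C.map (algebraMap ℚ (AlgebraicClosure K)) := by
  rw [VariableChange.map_map]
  exact congrArg C.map (Subsingleton.elim _ _)

include hC in
/-- **The second half commutes with the lift**: `C` has rational coefficients, fixed by `τ`
(`VariableChange.map_toX`, `map_toY`). [folklore] -/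
theorem twistIso₂_symm_pointsMap (hτ : IsLiftOfAut σ τ) (P : geomPoints (W.baseChange K)) :
    (twistIso₂ W hC).symm (hτ.pointsMap W P) =
      hτ.pointsMap (W.quadraticTwist 1) ((twistIso₂ W hC).symm P) := by
  change (((W.baseChange K).baseChange (AlgebraicClosure K))).toAffine.Point at P
  rcases P with _ | ⟨x, y, h⟩
  · change (twistIso₂ W hC).symm (hτ.pointsMap W 0) =
      hτ.pointsMap (W.quadraticTwist 1) ((twistIso₂ W hC).symm 0)
    simp only [map_zero]
  · obtain ⟨h1, e1⟩ := hτ.pointsMap_some W h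
    obtain ⟨h2, e2⟩ := twistPointsIso_some (map_smul_baseChange_eq_quadraticTwist_one W hC (K := K)) h1
    obtain ⟨h3, e3⟩ := twistPointsIso_some (map_smul_baseChange_eq_quadraticTwist_one W hC (K := K)) h
    obtain ⟨h4, e4⟩ := hτ.pointsMap_some (W.quadraticTwist 1) h3
    change (twistIso₂ W hC).symm (hτ.pointsMap W (show geomPoints _ from .some x y h)) = _
    rw [e1, twistIso₂, AddEquiv.symm_symm, e2, e3, e4]
    apply Affine.Point.some_eq_some_of_eq
    · rw [map_map_algebraMap]
      exact (VariableChange.map_toX C hτ.algEquiv.toAlgHom x).symm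
    · rw [map_map_algebraMap]
      exact (VariableChange.map_toY C hτ.algEquiv.toAlgHom x y).symm

include hc hC in
/-- **The sign rule for the twist isomorphism**: for a lift `τ` of `σ ∈ Aut(K/ℚ)` with
`σ θ = -θ` and every `P ∈ E^{(c)}_K(K̄)`, `twistIso (τ P) = -(τ (twistIso P))`: the Galois module
`E^{(c)}(K̄)` is `E(K̄)` twisted by the quadratic character of `K/ℚ` (T. Dokchitser 2013, §4:
`E_α ≅ E` over `K(√α)`; Silverman, *AEC*, X.2 Prop. 2.4). [cite: SilvermanAEC2009, X.5 Cor. 5.4] -/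
theorem twistIso_pointsMap_of_neg (hτ : IsLiftOfAut σ τ) (hσ : σ θ = -θ)
    (P : geomPoints ((W.quadraticTwist c).baseChange K)) :
    twistIso W hθ hc hC (hτ.pointsMap (W.quadraticTwist c) P) =
      -hτ.pointsMap W (twistIso W hθ hc hC P) := by
  change twistIso₂ W hC (twistIso₁ W hθ hc (hτ.pointsMap (W.quadraticTwist c) P)) =
    -hτ.pointsMap W (twistIso₂ W hC (twistIso₁ W hθ hc P))
  rw [twistIso₁_pointsMap_of_neg W hθ hc hτ hσ, map_neg, neg_inj]
  conv_rhs => rw [← (twistIso₂ W hC).apply_symm_apply (hτ.pointsMap W _)]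
  rw [twistIso₂_symm_pointsMap W hC hτ, AddEquiv.symm_apply_apply]

end Twist

end Literature.NumberTheory.EllipticCurves
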